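import Summits.FinalStateConjecture.FinalStateConjecture.Theorems.KerrShieldedDataExist.Negative.BentSlopeBounds
import Literature.Geometry.Lorentzian.KerrData
import HarnessLib

/-!
# `KerrShieldedDataExist` — the hard-coded bent slice is spacelike: the conormal certificate (part 3 of 3)

Support / tightness lemmas for crux `stmt-FinalStateConjecture-10055` (route SwallowTheDatum), continuing
`BentSlopeBounds.lean`. In ingoing Kerr–Schild coordinates the conormal of the graph `t* = T(r)` is
`n = dt* − T′ dr` and `Σ · g⁻¹(n, n) = −(r² + a²c²) + T′²(r² + a²) − 2Mr(1 + T′)²` (`Σ = r² + a²c²`,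
`c = z/r`; derived from `g⁻¹ = η⁻¹ − 2H ℓ♯⊗ℓ♯`, `η⁻¹(dr,dr) = (r²+a²)/Σ`, `ℓ♯·dr = 1`, `ℓ♯·dt* = −1`,
and independently from the ingoing Kerr form `a² sin²θ − 2(1+T′)(r²+a²) + (1+T′)²Δ`). The graph is
SPACELIKE at a point iff this `conormalForm` is negative there (then `−g♯n/|n|` is the future unit normal,
future since `g⁻¹(n, dt*) = −1 − 2H(1 + T′) < 0` for `T′ ≥ 0`).

* **`conormalForm_bentSlope_neg`**: for `|a| < M`, every `r > 0` and every `c`,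
  `conormalForm M a r c (bentSlope M a r) < 0` — the slice clause of the crux cannot fail (route
  SwallowTheDatum, kill criterion (a)/slice); numerically `sup g⁻¹(n,n) = −1.148` (`r ≈ 6.65M`, `a = 0`),
  minimal critical-slope margin `0.795`. Proof: `T′ = 0` below `4M`; `Δ T′ = 2Mr` beyond `8M`; on the
  annulus the window caps of part 2 and convexity in `T′` reduce it to three polynomial inequalities.
* Tightness (`a = 0`): `conormalForm = r (t+1)((r−2M)t − (r+2M))`, so for `r > 2M`, `t ≥ 0` a graph of
  slope `t` is spacelike iff `t < (r + 2M)/(r − 2M)`, and the conormal is null AT the critical slope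
  (`conormalForm_zero_spin_critical`): the certificate's bound cannot be improved; inside the horizon every
  nonnegative slope is spacelike. (Numerical tightness of the WINDOW, recorded in the work file: the
  transition could start as low as `2.5M` — `χ((r − αM)/αM)` on `[αM, 2αM]` is spacelike for `α ≥ 2.5`,
  fails for `α = 2.2` at `r ≈ 3.6M`, `a = 0`; rotation only helps.)
* Plumbing: `radius_ofTimeSpace` (the Kerr–Schild radius is time-independent), `ofTimeSpace_mem_region`,
  `graph`, `psi_eq_graph` (the crux's graph clause PINS `ψ`), `graph_eq_sliceEmbed_of_le` (on `r ≤ 4M`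
  the graph is `Kerr.sliceEmbed`, whose spacelikeness and future unit normal are the tree's
  `Kerr.isSpacelikeImmersion_sliceEmbed_holds`, `Kerr.isFutureUnitNormal_sliceNormal_holds`).

References: Dafermos–Rodnianski arXiv:0811.0354 §5.1; Cook, Living Rev. Relativ. 3 (2000) §3.2.2;
Visser arXiv:0706.0622 (33)–(35).
-/

noncomputable section

open Real Set Filter Topology
open scoped Manifold ContDiff
open Literature.Geometry.Lorentzian
open Literature.NumberTheory.Sieve.GreenTao2008 (deriv_smoothTransition_nonneg deriv_smoothTransition_le_two)
open Literature.Analysis.Calculus (differentiable_smoothTransition deriv_smoothTransition_of_nonpos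
  deriv_smoothTransition_of_one_le)

namespace Summit.FinalStateConjecture.FinalStateConjecture.Theorems.KerrShieldedDataExist.Negative

/-! ## §5 The conormal form of the graph `t* = T(r)`: the cheapest falsifier, as a theorem -/

section Conormal

variable {M a : ℝ}

/-- `Σ · g⁻¹(n, n)` for the conormal `n = dt* − t dr` of a graph `t* = T(r)` with slope `t = T′(r)`
at a point of Kerr–Schild radius `r` and polar cosine `c = z/r` in ingoing Kerr–Schild coordinates:
`g⁻¹ = η⁻¹ − 2H ℓ♯ ⊗ ℓ♯`, `H = Mr/Σ`, `Σ = r² + a²c²`, `η⁻¹(dr, dr) = (r² + a²)/Σ`, `ℓ♯ · dr = 1`,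
`ℓ♯ · dt* = −1`, whence `Σ g⁻¹(n,n) = −Σ + t²(r² + a²) − 2Mr(1 + t)²`. The graph is SPACELIKE at the
point iff this is `< 0` (then `−g♯ n/|n|` is its future unit normal, future because
`g⁻¹(n, dt*) = −(1 + 2H(1 + t))/… < 0` for `t ≥ 0`). [cite: arXiv08110354, §5.1] [cite: Cook2000, §3.2.2] -/
def conormalForm (M a r c t : ℝ) : ℝ :=
  -(r ^ 2 + a ^ 2 * c ^ 2) + t ^ 2 * (r ^ 2 + a ^ 2) - 2 * M * r * (1 + t) ^ 2

/-- A convex quadratic on `[0, cap]` is bounded by the larger of its endpoint values. [folklore] -/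
theorem quad_le_max {D L K t cap : ℝ} (hD : 0 ≤ D) (ht0 : 0 ≤ t) (ht : t ≤ cap) :
    D * t ^ 2 + L * t + K ≤ max K (D * cap ^ 2 + L * cap + K) := by
  have h1 : D * t ^ 2 ≤ D * (cap * t) := by
    apply mul_le_mul_of_nonneg_left _ hD; nlinarith
  rcases le_or_gt 0 (D * cap + L) with hpos | hneg
  · have h2 : t * (D * cap + L) ≤ cap * (D * cap + L) := mul_le_mul_of_nonneg_right ht hpos
    calc D * t ^ 2 + L * t + K ≤ K + t * (D * cap + L) := by nlinarith
      _ ≤ D * cap ^ 2 + L * cap + K := by nlinarith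
      _ ≤ max K (D * cap ^ 2 + L * cap + K) := le_max_right _ _
  · have h2 : t * (D * cap + L) ≤ 0 := mul_nonpos_iff.2 (Or.inl ⟨ht0, hneg.le⟩)
    calc D * t ^ 2 + L * t + K ≤ K + t * (D * cap + L) := by nlinarith
      _ ≤ K := by linarith
      _ ≤ max K (D * cap ^ 2 + L * cap + K) := le_max_left _ _

/-- The conormal form as a quadratic in the slope: `Q(t) = Δ t² − 4Mr t − (2Mr + Σ)`. [folklore] -/
theorem conormalForm_eq (M a r c t : ℝ) :
    conormalForm M a r c t =
      (r ^ 2 - 2 * M * r + a ^ 2) * t ^ 2 + (-(4 * M * r)) * t + (-(2 * M * r + (r ^ 2 + a ^ 2 * c ^ 2))) := by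
  unfold conormalForm; ring

/-- Window step: if on a radius window the slope is in `[0, cap]` and the endpoint polynomial
`(r² − 2Mr + M²) cap² − 4Mr cap − 2Mr − r²` is negative, the conormal form is negative there
(`Δ ≤ r² − 2Mr + M²` by `a² < M²`, `Σ ≥ r²`). [folklore] -/
theorem conormalForm_neg_of_cap (h : |a| < M) {r t cap : ℝ} (hr : Kerr.rPlus M a < r) (hr0 : 0 < r)
    (ht0 : 0 ≤ t) (ht : t ≤ cap)
    (hP : (r ^ 2 - 2 * M * r + M ^ 2) * cap ^ 2 - 4 * M * r * cap - 2 * M * r - r ^ 2 < 0) (c : ℝ) :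
    conormalForm M a r c t < 0 := by
  have hM := mass_pos h
  have hΔ := delta_pos h hr
  have ha2 : a ^ 2 < M ^ 2 := by nlinarith [sq_sub_sq_pos h]
  rw [conormalForm_eq]
  refine (quad_le_max hΔ.le ht0 ht).trans_lt (max_lt ?_ ?_)
  · nlinarith [sq_nonneg (a * c)]
  · nlinarith [sq_nonneg (a * c), mul_nonneg (sq_nonneg cap) (sub_nonneg.2 ha2.le), sq_nonneg cap]

/-- **THE CHEAPEST FALSIFIER, AS A THEOREM (uniform in the latitude `c` and in `|a| < M`).**
For every sub-extremal `(M, a)` and every `r > 0`,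
`Σ · g⁻¹(n, n) = −(r² + a²c²) + T′(r)²(r² + a²) − 2Mr(1 + T′(r))² < 0`,
`T′ = bentSlope M a = deriv (bentHeight M a)` the slope of the LITERAL hard-coded height of the crux:
below `4M` `T′ = 0`; on `[8M, ∞)` `T′ = 2Mr/Δ` and the form equals `−Σ − 2Mr(1 + T′)`; on the annulus
the slope caps `17/10, 3/2, 8/5` of §4 and convexity in `T′` reduce it to three polynomial
inequalities in `r/M`. So the hard-coded slice is spacelike at every point of `Kerr.region a r₁` it
visits, for EVERY junction radius and every sub-extremal spin: the 'cheap technical death' of the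
line (planner's kill criterion (a), slice clause) does NOT occur. Numerically `sup g⁻¹(n,n) = −1.148`
(`r ≈ 6.65M`, `a = 0`, worst latitude irrelevant there), min critical-slope margin `0.795`.
[cite: arXiv08110354, §5.1] [cite: Cook2000, §3.2.2] -/
theorem conormalForm_bentSlope_neg (h : |a| < M) {r : ℝ} (hr0 : 0 < r) (c : ℝ) :
    conormalForm M a r c (bentSlope M a r) < 0 := by
  have hM := mass_pos h
  have ht0 := bentSlope_nonneg h r
  rcases le_or_gt r (4 * M) with h4 | h4
  · -- Kerr–Schild zone: `T′ = 0`
    rw [bentSlope_eq_zero_of_le hM h4]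
    unfold conormalForm
    nlinarith [sq_nonneg (a * c), mul_pos hM hr0]
  have hrp : Kerr.rPlus M a < r := (rPlus_lt_four_mul h).trans h4
  rcases le_or_gt (8 * M) r with h8 | h8
  · -- Boyer–Lindquist zone: `Δ T′ = 2Mr`
    have hΔ := delta_pos h hrp
    have e := bentSlope_eq_of_ge hM h8 (a := a)
    set t := bentSlope M a r
    have hΔt : (r ^ 2 - 2 * M * r + a ^ 2) * t = 2 * M * r := by
      rw [e, mul_comm, div_mul_cancel₀ _ hΔ.ne']
    have key : conormalForm M a r c t = -(r ^ 2 + a ^ 2 * c ^ 2) - 2 * M * r * (1 + t) := by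
      unfold conormalForm; nlinarith [hΔt]
    rw [key]
    nlinarith [sq_nonneg (a * c), mul_pos hM hr0]
  -- transition annulus, three windows
  rcases le_or_gt r (6 * M) with h6 | h6
  · exact conormalForm_neg_of_cap h hrp hr0 ht0 (bentSlope_lt_cap₁ h h4 h6).le
      (by nlinarith [mul_nonneg (sub_nonneg.2 h4.le) (sub_nonneg.2 h6), mul_pos hM hM]) c
  rcases le_or_gt r (7 * M) with h7 | h7
  · exact conormalForm_neg_of_cap h hrp hr0 ht0 (bentSlope_lt_cap₂ h h6.le h7).le
      (by nlinarith [mul_nonneg (sub_nonneg.2 h6.le) (sub_nonneg.2 h7), mul_pos hM hM]) c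
  · exact conormalForm_neg_of_cap h hrp hr0 ht0 (bentSlope_lt_cap₃ h h7.le h8.le).le
      (by nlinarith [mul_nonneg (sub_nonneg.2 h7.le) (sub_nonneg.2 h8.le), mul_pos hM hM]) c

/-- The same statement with `deriv (bentHeight M a)` in place of the named slope. [folklore] -/
theorem conormalForm_deriv_bentHeight_neg (h : |a| < M) {r : ℝ} (hr0 : 0 < r) (c : ℝ) :
    conormalForm M a r c (deriv (bentHeight M a) r) < 0 := by
  rw [deriv_bentHeight h]; exact conormalForm_bentSlope_neg h hr0 c

end Conormal

/-! ## §5b Tightness of the certificate at zero spin -/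

section Tightness

variable {M : ℝ}

/-- For `a = 0` the conormal form factorises: `Q = r (t + 1) ((r − 2M) t − (r + 2M))`. [folklore] -/
theorem conormalForm_zero_spin (M r c t : ℝ) :
    conormalForm M 0 r c t = r * (t + 1) * ((r - 2 * M) * t - (r + 2 * M)) := by
  unfold conormalForm; ring

/-- **The critical slope is sharp.** For `a = 0`, `r > 2M` and `t ≥ 0`, the graph of slope `t` is spacelike
at radius `r` iff `t < (r + 2M)/(r − 2M)`; at `t = (r + 2M)/(r − 2M)` the conormal is null (the bound of
the certificate cannot be improved). E.g. at `r = 6M` the critical slope is `2`, the hard-coded slope is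
`< 3/2`. [folklore] -/
theorem conormalForm_zero_spin_neg_iff {r t : ℝ} (hr : 2 * M < r) (hr0 : 0 < r) (ht : 0 ≤ t) :
    conormalForm M 0 r 0 t < 0 ↔ t < (r + 2 * M) / (r - 2 * M) := by
  rw [conormalForm_zero_spin, lt_div_iff₀ (sub_pos.2 hr)]
  constructor
  · intro h
    by_contra hle
    rw [not_lt] at hle
    have : 0 ≤ r * (t + 1) * ((r - 2 * M) * t - (r + 2 * M)) :=
      mul_nonneg (mul_nonneg hr0.le (by linarith)) (by linarith)
    linarith
  · intro h
    have h1 : 0 < r * (t + 1) := mul_pos hr0 (by linarith)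
    have h2 : (r - 2 * M) * t - (r + 2 * M) < 0 := by linarith
    nlinarith

/-- At the critical slope the conormal of the graph is null (`Q = 0`). [folklore] -/
theorem conormalForm_zero_spin_critical {r : ℝ} (hr : 2 * M < r) (c : ℝ) :
    conormalForm M 0 r c ((r + 2 * M) / (r - 2 * M)) = 0 := by
  rw [conormalForm_zero_spin]
  have : (r - 2 * M) * ((r + 2 * M) / (r - 2 * M)) - (r + 2 * M) = 0 := by
    rw [mul_div_cancel₀ _ (sub_pos.2 hr).ne']; ring
  rw [this, mul_zero]

/-- Inside the horizon every nonnegative slope is spacelike (`a = 0`, `0 < r < 2M`): the bending could be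
anything there; the crux keeps `T ≡ 0`. [folklore] -/
theorem conormalForm_zero_spin_neg_of_lt {r t : ℝ} (hr0 : 0 < r) (hr : r < 2 * M) (ht : 0 ≤ t) (c : ℝ) :
    conormalForm M 0 r c t < 0 := by
  rw [conormalForm_zero_spin]
  have h1 : 0 < r * (t + 1) := mul_pos hr0 (by linarith)
  have h2 : (r - 2 * M) * t - (r + 2 * M) < 0 := by nlinarith
  nlinarith

end Tightness


/-! ## §6 The pinned immersion: the graph of `T ∘ r` over the Kerr–Schild slice -/

section Graph

variable {M a r₁ : ℝ}

/-- The Kerr–Schild radius does not depend on `t*`: `r(a, (t, y)) = r(a, (0, y))`. [cite: arXiv07060622, (35)] -/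
theorem radius_ofTimeSpace (a t : ℝ) (y : E3) :
    Kerr.radius a (E4.ofTimeSpace t y) = Kerr.radius a (E4.ofTimeSpace 0 y) := by
  have h3 : ∀ s : ℝ, E4.ofTimeSpace s y 3 = y 2 := fun s => E4.ofTimeSpace_apply_succ s y 2
  simp only [Kerr.radius, E4.spatialNorm_ofTimeSpace, h3]

/-- Hence every lift `(t, y)` of a slice point lies in the chart domain `Kerr.region a r₁`. [folklore] -/
theorem ofTimeSpace_mem_region (t : ℝ) {y : E3} (hy : y ∈ Kerr.slice a r₁) :
    E4.ofTimeSpace t y ∈ Kerr.region a r₁ := by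
  rw [Kerr.mem_region, radius_ofTimeSpace]; exact hy

variable (M a r₁) in
/-- The graph `y ↦ (T(r(y)), y)` of the hard-coded height over the Kerr–Schild slice. [folklore] -/
def graph : Kerr.slice a r₁ → Kerr.region a r₁ := fun y =>
  ⟨E4.ofTimeSpace (bentHeight M a (Kerr.radius a (E4.ofTimeSpace 0 (y : E3)))) y,
    ofTimeSpace_mem_region _ y.2⟩

/-- Unfolding lemma for `graph`. [folklore] -/
@[simp] theorem coe_graph (y : Kerr.slice a r₁) :
    (graph M a r₁ y : E4) = E4.ofTimeSpace (bentHeight M a (Kerr.radius a (E4.ofTimeSpace 0 (y : E3)))) y :=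
  rfl

/-- **Conjunct 7 pins `ψ`.** Any `ψ` satisfying the crux's graph clause with the crux's literal `T` IS
`graph M a r₁` — the immersion is not a degree of freedom of the witness (only `D` off `range φ`, the
chart `φ`, the end chart and the sign-determined normal are). [folklore] -/
theorem psi_eq_graph {T : ℝ → ℝ} (hT : T = bentHeight M a)
    {ψ : Kerr.slice a r₁ → Kerr.region a r₁}
    (hψ : ∀ y : Kerr.slice a r₁, (ψ y : E4) =
      E4.ofTimeSpace (T (Kerr.radius a (E4.ofTimeSpace 0 (y : E3)))) (y : E3)) :
    ψ = graph M a r₁ := by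
  funext y; apply Subtype.ext; rw [hψ y, hT]; rfl

/-- **On `r ≤ 4M` the graph is the Kerr–Schild slice embedding** `Kerr.sliceEmbed` (`T = 0` there), whose
spacelikeness and future unit normal are theorems of the tree
(`Kerr.isSpacelikeImmersion_sliceEmbed_holds`, `Kerr.isFutureUnitNormal_sliceNormal_holds`): the
near-junction part of the slice clause costs the prover nothing. [cite: Cook2000, §3.2.2] -/
theorem graph_eq_sliceEmbed_of_le (hM : 0 < M) {y : Kerr.slice a r₁}
    (hy : Kerr.radius a (E4.ofTimeSpace 0 (y : E3)) ≤ 4 * M) :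
    graph M a r₁ y = Kerr.sliceEmbed a r₁ y := by
  apply Subtype.ext
  rw [coe_graph, bentHeight_eq_zero_of_le hM hy, Kerr.coe_sliceEmbed]

/-- The graph is injective (it is a section of the projection `(t, y) ↦ y`). [folklore] -/
theorem graph_injective : Function.Injective (graph M a r₁) := by
  intro y y' h
  have h' := congrArg (fun p : Kerr.region a r₁ => E4.spatial (p : E4)) h
  simp only [coe_graph, E4.spatial_ofTimeSpace] at h'
  exact Subtype.ext h'

end Graph


end Summit.FinalStateConjecture.FinalStateConjecture.Theorems.KerrShieldedDataExist.Negative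

end
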